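import Literature.Probability.Percolation.MarkedLoopBoundarySpanCapIns
import HarnessLib

/-!
# Boundary span from NESTED families: one-step expansions with bounded drift suffice («BSPAN-NESTED-CRITERION»)

Topic `Literature/Probability/Percolation`; generic-`k` layer of the marked-loop (Khristoforov–Smirnov) lineage; a rider on `MarkedLoopBoundarySpanSideways.lean`
(«BSPAN-SIDEWAYS-CRITERION»: ★★ `bNonvanish_of_subfamily_stable_corners` — if the span of the laws of ONE family `T` is stable under every corner-pair generator `e_j` and
one pattern is realised, then `BNonvanish`) and `MarkedLoopBoundarySpanCapIns.lean` («BSPAN-CAPINS-CRITERION»: the same with the stability delivered by F2 + cap data).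

WHY. The surgery calculus of the BSPAN programme (SLIDE #848/#879, F2 #921/#945, TWO-CELL CAP #1035/`MarkedLoopTwoCellOfDarts`) expresses `e_j (lawLP z)` for a lawpoint `z`
of a tame class as a signed sum of laws of OTHER lawpoints of the class, whose hanging cells and marks may sit a bounded number of steps OUTSIDE the region occupied by the
features of `z` («drift»; HOME `FINDING-BSPAN-BR-SURGERY-NUMERICS.md` §3–§4). A single family closed under «being a term of an expansion» therefore has to contain lawpoints
crowded against the ends of the base strip, for which no expansion exists (ibid. §3: exhaustive search). This file removes the need for exact closure: a NESTED chain of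
families `T 0 ⊆ T 1 ⊆ ⋯` in which every member of `T i` expands into laws of `T (i+1)` already gives `BNonvanish` — because the spans form a monotone chain of subspaces of a
finite-dimensional space, so two consecutive spans coincide after at most `finrank` steps, and that span is stable.

* ★ `submodule_exists_succ_eq_of_monotone` — a monotone sequence of subspaces of a finite-dimensional space has `W i = W (i+1)` for some `i ≤ finrank`;
* ★★ `submodule_exists_stable_of_monotone` — if moreover linear maps `f j` send `W i` into `W (i+1)`, some `W i`, `i ≤ finrank`, is stable under every `f j`;
* ★★★ `bNonvanish_of_nested_stable_corners` / `bSpan_of_nested_stable_corners'` — **THE NESTED CORNER-PAIR CRITERION**: `T : ℕ → Set (lawpoints)` monotone, one pattern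
  realised in `T 0`, and for every `i`, every corner pair `j ≤ 2m−1` and every `z ∈ T i`, `e_j (lawLP z) ∈ span (lawLP (T (i+1)))` ⇒ `BNonvanish (2m+1)` (home arc), `BSpan`
  on every arc;
* ★★★ `bNonvanish_of_nested_capIns` / `bSpan_of_nested_capIns'` — the same with the one-step stability delivered, as in #887, by F2 (`contractL j (lawLP w) = X₁ − X₀`) and cap
  data `capInsL j X₀, capInsL j X₁ ∈ span (lawLP (T (i+1)))` (any cap identity, e.g. the four-term two-cell cap identity) for members `w ∈ T (i+1)` whose laws span `lawLP z`.

## References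
* M. Khristoforov, S. Smirnov, *Percolation and O(1) loop model*, arXiv:2111.15612 (2021), §1.2 (arXiv v1 p. 2), §2 eq. (4) and Remark 6 (p. 5).
* D. Ridout, Y. Saint-Aubin, *Standard modules, induction and the structure of the Temperley–Lieb algebra*, Adv. Theor. Math. Phys. 18 (2014) = arXiv:1204.4505, §3
  Prop. 3.3 (arXiv p. 13) (cyclicity of the standard module under the `e_j`).
* P. A. Pearce, V. Rittenberg, J. de Gier, B. Nienhuis, *Temperley–Lieb stochastic processes*, J. Phys. A 35 (2002) L661–L668, §2 (the monoid move `e_j`; cup–cap).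

## Mathlib / tree
Tree: `MarkedLoopBoundarySpanSideways` (`bNonvanish_of_subfamily_stable_corners`), `MarkedLoopBoundarySpanCapIns` (`tlL_one_mem_of_capInsL_mem`), `MarkedLoopBoundarySpan`
(`ArcPoint`, `BSpan`, `BNonvanish`, `bSpan_iff_bNonvanish`, `bNonvanish_iff`), `MarkedLoopBoundaryLawModule` (`lawLP`), `LatticeModels/TemperleyLiebCapContract` (`tlL`,
`capInsL`, `contractL`). Mathlib: `Submodule.finrank_lt_finrank_of_lt`, `Submodule.finrank_le`, `Submodule.map_le_iff_le_comap`, `Submodule.span_le`, `Submodule.span_mono`,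
`Submodule.span_induction`.
-/

open Finset

/-! ### Linear algebra: a monotone chain of subspaces stabilises within `finrank` steps -/

namespace Literature.Probability.Percolation.MarkedLoops

section LinearAlgebra

variable {K : Type*} [DivisionRing K] {V : Type*} [AddCommGroup V] [Module K V] [FiniteDimensional K V]

/-- ★ a monotone sequence of subspaces of a finite-dimensional space repeats within `finrank` steps: `W i = W (i+1)` for some `i ≤ finrank K V` (otherwise the dimensions would
climb to `finrank K V + 1`). [cite: RidoutSaintAubin2014TL, §3 Prop. 3.3 (arXiv p. 13); lane plumbing] -/
theorem submodule_exists_succ_eq_of_monotone (W : ℕ → Submodule K V) (hW : Monotone W) : ∃ i ≤ Module.finrank K V, W i = W (i + 1) := by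
  by_contra h
  push Not at h
  -- every step up to `finrank` is strict, so the dimension climbs by one each time
  have climb : ∀ n ≤ Module.finrank K V + 1, n ≤ Module.finrank K (W n) := by
    intro n hn
    induction n with
    | zero => exact Nat.zero_le _
    | succ n ih =>
      have hlt : W n < W (n + 1) := lt_of_le_of_ne (hW (Nat.le_succ n)) (h n (by omega))
      have hdim : Module.finrank K (W n) < Module.finrank K (W (n + 1)) := Submodule.finrank_lt_finrank_of_lt hlt
      have := ih (by omega)
      omega
  have htop : Module.finrank K (W (Module.finrank K V + 1)) ≤ Module.finrank K V := Submodule.finrank_le _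
  have := climb (Module.finrank K V + 1) le_rfl
  omega

/-- ★★ **a monotone chain mapped one step up by a family of linear maps has a STABLE member within `finrank` steps.**
[cite: RidoutSaintAubin2014TL, §3 Prop. 3.3 (arXiv p. 13); lane plumbing] -/
theorem submodule_exists_stable_of_monotone {ι : Type*} (W : ℕ → Submodule K V) (hW : Monotone W) (f : ι → V →ₗ[K] V)
    (hf : ∀ i j, (W i).map (f j) ≤ W (i + 1)) : ∃ i ≤ Module.finrank K V, ∀ j, (W i).map (f j) ≤ W i := by
  obtain ⟨i, hi, he⟩ := submodule_exists_succ_eq_of_monotone W hW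
  exact ⟨i, hi, fun j => he ▸ (he ▸ hf i j : (W i).map (f j) ≤ W (i + 1))⟩

end LinearAlgebra

open Literature.Probability.Percolation Literature.Probability.LatticeModels
open Literature.Probability.LatticeModels.TemperleyLieb
open TriMarkedDomain

/-! ### The nested corner-pair criterion -/

section Nested

variable {m : ℕ}

/-- the span of the home-arc laws of a family of lawpoints (abbreviation used in this file's statements only through `Submodule.span`).
[cite: KhristoforovSmirnov2021, §2 eq. (4) (arXiv v1 p. 5); lane plumbing] -/
theorem span_lawLP_mono {T T' : Set (Σ D : TriMarkedDomain (2 * m + 1), ArcPoint D (Fin.last (2 * m)))} (h : T ⊆ T') :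
    Submodule.span ℂ (Set.range fun ww : T => lawLP ww.1.2) ≤ Submodule.span ℂ (Set.range fun ww : T' => lawLP ww.1.2) := by
  refine Submodule.span_mono ?_
  rintro _ ⟨ww, rfl⟩
  exact ⟨⟨ww.1, h ww.2⟩, rfl⟩

/-- ★★★ **THE NESTED CORNER-PAIR CRITERION.** Let `T 0 ⊆ T 1 ⊆ ⋯` be families of home-arc lawpoints of `(2m+1)`-marked domains, with one pattern realised at a member of
`T 0`. If for every `i`, every corner pair `j ≤ 2m−1` and every `z ∈ T i` the vector `e_j (lawLP z)` lies in the span of the laws of `T (i+1)` (a ONE-STEP expansion — the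
terms may leave `T i`), then `BNonvanish (2m+1)` holds on the home arc: the spans stabilise within `finrank` steps (`submodule_exists_stable_of_monotone`) and the
stable one is everything by the sub-family criterion. [cite: KhristoforovSmirnov2021, §2 eq. (4) and Remark 6 (arXiv v1 p. 5); RidoutSaintAubin2014TL, §3 Prop. 3.3 (arXiv p. 13); PearceRittenbergDeGierNienhuis2002, §2] -/
theorem bNonvanish_of_nested_stable_corners (T : ℕ → Set (Σ D : TriMarkedDomain (2 * m + 1), ArcPoint D (Fin.last (2 * m)))) (hmono : Monotone T)
    (hstep : ∀ (i : ℕ) (j : Fin (2 * m + 1)), j.val < 2 * m → ∀ zz : T i,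
      tlL ℂ 1 j (lawLP zz.1.2) ∈ Submodule.span ℂ (Set.range fun ww : T (i + 1) => lawLP ww.1.2))
    (h0 : ∃ zz : T 0, ∃ q : Pat₀ (2 * m + 1), patternCount zz.1.1 zz.1.2.v zz.1.2.i q.1 ≠ 0) :
    BNonvanish (2 * m + 1) (Fin.last (2 * m)) := by
  set W : ℕ → Submodule ℂ (LinkPattern (2 * m + 1 + 1) →₀ ℂ) := fun i => Submodule.span ℂ (Set.range fun ww : T i => lawLP ww.1.2) with hW
  have hWmono : Monotone W := fun i i' h => span_lawLP_mono (hmono h)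
  -- the generators `e_j`, `j < 2m`, map `W i` into `W (i+1)` (indexed by all `j`; for `j ≥ 2m` use the zero map)
  classical
  let f : Fin (2 * m + 1) → (LinkPattern (2 * m + 1 + 1) →₀ ℂ) →ₗ[ℂ] (LinkPattern (2 * m + 1 + 1) →₀ ℂ) := fun j => if j.val < 2 * m then tlL ℂ 1 j else 0
  have hf : ∀ i j, (W i).map (f j) ≤ W (i + 1) := by
    intro i j
    by_cases hj : j.val < 2 * m
    · simp only [f, if_pos hj]
      rw [Submodule.map_span_le]
      rintro _ ⟨zz, rfl⟩
      exact hstep i j hj zz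
    · simp only [f, if_neg hj, Submodule.map_zero]
      exact bot_le
  obtain ⟨i, -, hstab⟩ := submodule_exists_stable_of_monotone W hWmono f hf
  -- the stable family `T i` satisfies the sub-family criterion
  refine bNonvanish_of_subfamily_stable_corners (T i) (fun j hj zz => ?_) ?_
  · have h := hstab j
    simp only [f, if_pos hj] at h
    exact h (Submodule.mem_map_of_mem (Submodule.subset_span ⟨zz, rfl⟩))
  · obtain ⟨zz, q, hq⟩ := h0
    exact ⟨⟨zz.1, hmono (Nat.zero_le i) zz.2⟩, q, hq⟩

/-- ★★★ **… and boundary span on EVERY arc** (`k = 2m+3 ≥ 3`). [cite: KhristoforovSmirnov2021, §1.2 (arXiv v1 p. 2: cyclic indexing); §2 eq. (4) (p. 5); RidoutSaintAubin2014TL, §3 Prop. 3.3 (arXiv p. 13)] -/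
theorem bSpan_of_nested_stable_corners' {m : ℕ} (T : ℕ → Set (Σ D : TriMarkedDomain (2 * (m + 1) + 1), ArcPoint D (Fin.last (2 * (m + 1))))) (hmono : Monotone T)
    (hstep : ∀ (i : ℕ) (j : Fin (2 * (m + 1) + 1)), j.val < 2 * (m + 1) → ∀ zz : T i,
      tlL ℂ 1 j (lawLP zz.1.2) ∈ Submodule.span ℂ (Set.range fun ww : T (i + 1) => lawLP ww.1.2))
    (h0 : ∃ zz : T 0, ∃ q : Pat₀ (2 * (m + 1) + 1), patternCount zz.1.1 zz.1.2.v zz.1.2.i q.1 ≠ 0)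
    (a : Fin (2 * (m + 1) + 1)) : BSpan (2 * (m + 1) + 1) a ∧ BNonvanish (2 * (m + 1) + 1) a := by
  have h := bNonvanish_of_nested_stable_corners T hmono hstep h0
  have ha : BNonvanish (2 * (m + 1) + 1) a := (bNonvanish_iff (n := 2 * m + 1) a (Fin.last (2 * (m + 1)))).2 h
  exact ⟨(bSpan_iff_bNonvanish a).2 ha, ha⟩

/-! ### The nested criterion with F2 and cap data (the shape the surgery calculus delivers) -/

/-- ★★★ **NESTED ASSEMBLY WITH F2 AND CAP DATA.** `T 0 ⊆ T 1 ⊆ ⋯` families of home-arc lawpoints with one realised pattern in `T 0`; suppose that for every `i`, every corner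
pair `j ≤ 2m−1` and every `z ∈ T i` the law `lawLP z` lies in the span of the laws of those `w ∈ T (i+1)` admitting `X₀, X₁` with `contractL j (lawLP w) = X₁ − X₀` (F2) and
`capInsL j X₀, capInsL j X₁ ∈ span (lawLP (T (i+1)))` (any cap identity: the four terms of the two-cell cap identity may be ANY members of `T (i+1)`). Then
`BNonvanish (2m+1)` on the home arc. [cite: KhristoforovSmirnov2021, §2 eq. (4) and Remark 6 (arXiv v1 p. 5); RidoutSaintAubin2014TL, §3 Prop. 3.3 (arXiv p. 13); PearceRittenbergDeGierNienhuis2002, §2 ((monoid): `e_j` = cup–cap)] -/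
theorem bNonvanish_of_nested_capIns (T : ℕ → Set (Σ D : TriMarkedDomain (2 * m + 1), ArcPoint D (Fin.last (2 * m)))) (hmono : Monotone T)
    (h0 : ∃ zz : T 0, ∃ q : Pat₀ (2 * m + 1), patternCount zz.1.1 zz.1.2.v zz.1.2.i q.1 ≠ 0)
    (htight : ∀ (i : ℕ) (j : Fin (2 * m + 1)), j.val < 2 * m → ∀ zz : T i,
      lawLP zz.1.2 ∈ Submodule.span ℂ (Set.range fun ww : {ww : T (i + 1) //
          ∃ (X₀ X₁ : LinkPattern (2 * m) →₀ ℂ), contractL ℂ j (lawLP ww.1.2) = X₁ - X₀ ∧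
            capInsL ℂ j X₀ ∈ Submodule.span ℂ (Set.range fun vv : T (i + 1) => lawLP vv.1.2) ∧
              capInsL ℂ j X₁ ∈ Submodule.span ℂ (Set.range fun vv : T (i + 1) => lawLP vv.1.2)} => lawLP ww.1.1.2)) :
    BNonvanish (2 * m + 1) (Fin.last (2 * m)) := by
  refine bNonvanish_of_nested_stable_corners T hmono (fun i j hj zz => ?_) h0
  set W := Submodule.span ℂ (Set.range fun ww : T (i + 1) => lawLP ww.1.2) with hW
  have key : ∀ x, x ∈ Submodule.span ℂ (Set.range fun ww : {ww : T (i + 1) //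
      ∃ (X₀ X₁ : LinkPattern (2 * m) →₀ ℂ), contractL ℂ j (lawLP ww.1.2) = X₁ - X₀ ∧
        capInsL ℂ j X₀ ∈ Submodule.span ℂ (Set.range fun vv : T (i + 1) => lawLP vv.1.2) ∧
          capInsL ℂ j X₁ ∈ Submodule.span ℂ (Set.range fun vv : T (i + 1) => lawLP vv.1.2)} => lawLP ww.1.1.2) → tlL ℂ 1 j x ∈ W := by
    intro x hx
    refine Submodule.span_induction ?_ ?_ ?_ ?_ hx
    · rintro _ ⟨⟨ww, X₀, X₁, hF2, hX₀, hX₁⟩, rfl⟩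
      exact tlL_one_mem_of_capInsL_mem j hF2 hX₀ hX₁
    · rw [map_zero]; exact W.zero_mem
    · intro x y _ _ hx hy; rw [map_add]; exact W.add_mem hx hy
    · intro c x _ hx; rw [map_smul]; exact W.smul_mem c hx
  exact key _ (htight i j hj zz)

/-- ★★★ **… and boundary span on EVERY arc** (`k = 2m+3 ≥ 3`). [cite: KhristoforovSmirnov2021, §1.2 (arXiv v1 p. 2: cyclic indexing); §2 eq. (4) (p. 5); RidoutSaintAubin2014TL, §3 Prop. 3.3 (arXiv p. 13)] -/
theorem bSpan_of_nested_capIns' {m : ℕ} (T : ℕ → Set (Σ D : TriMarkedDomain (2 * (m + 1) + 1), ArcPoint D (Fin.last (2 * (m + 1))))) (hmono : Monotone T)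
    (h0 : ∃ zz : T 0, ∃ q : Pat₀ (2 * (m + 1) + 1), patternCount zz.1.1 zz.1.2.v zz.1.2.i q.1 ≠ 0)
    (htight : ∀ (i : ℕ) (j : Fin (2 * (m + 1) + 1)), j.val < 2 * (m + 1) → ∀ zz : T i,
      lawLP zz.1.2 ∈ Submodule.span ℂ (Set.range fun ww : {ww : T (i + 1) //
          ∃ (X₀ X₁ : LinkPattern (2 * (m + 1)) →₀ ℂ), contractL ℂ j (lawLP ww.1.2) = X₁ - X₀ ∧
            capInsL ℂ j X₀ ∈ Submodule.span ℂ (Set.range fun vv : T (i + 1) => lawLP vv.1.2) ∧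
              capInsL ℂ j X₁ ∈ Submodule.span ℂ (Set.range fun vv : T (i + 1) => lawLP vv.1.2)} => lawLP ww.1.1.2))
    (a : Fin (2 * (m + 1) + 1)) : BSpan (2 * (m + 1) + 1) a ∧ BNonvanish (2 * (m + 1) + 1) a := by
  have h := bNonvanish_of_nested_capIns T hmono h0 htight
  have ha : BNonvanish (2 * (m + 1) + 1) a := (bNonvanish_iff (n := 2 * m + 1) a (Fin.last (2 * (m + 1)))).2 h
  exact ⟨(bSpan_iff_bNonvanish a).2 ha, ha⟩

end Nested

end Literature.Probability.Percolation.MarkedLoops
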